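import Summits.AtomisticToContinuum.BoseEinsteinCondensation.Theses.BECDispersionLadder
import Literature.MathematicalPhysics.QuantumManyBody.PeriodicBoseGasFracEnergy

/-!
# AtomisticToContinuum / BoseEinsteinCondensation — route `BECDispersionLadder`, item `FracEnergyAtTwo`

Settles the support item `stmt-AtomisticToContinuum-14558` of route
`route-AtomisticToContinuum-BECDispersionLadder`: at the endpoint `α = 2` the kinetic-exponent dial
energy inlined in the route,
`E_2(Ψ) = ∑_{p ∈ ℤ³} |2πp/L|² n_Ψ(p) + ∫_{cell^N} ∑_{i<j} v^per(xᵢ - xⱼ)|Ψ|²`,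
equals the library's `periodicEnergy v Ψ` for every periodic trial state `Ψ` on a torus of side
`L > 0`.

The inlined `let E := fun ψ => …` is, definitionally, `BoseGas.fracPeriodicEnergy 2 v N L`
(`BoseGas.fracPeriodicEnergy_eq_inline`, `rfl`), and the identity is the Literature theorem
`BoseGas.fracPeriodicEnergy_two` (Parseval for `∇Ψ` on the 3-torus in the traced variable, Tonelli,
Bose symmetry), proved in `Literature/MathematicalPhysics/QuantumManyBody/PeriodicBoseGasFracEnergy.lean`.
-/

namespace Summit.AtomisticToContinuum.BoseEinsteinCondensation.Theorems

open Literature.MathematicalPhysics.QuantumManyBody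

/-- Settles `stmt-AtomisticToContinuum-14558` (exact signature): for `α = 2`, every `L > 0` and every
periodic trial state `Ψ`, the inlined dial energy `E_2(Ψ)` equals `BoseGas.periodicEnergy v Ψ`.
Proof: the inlined functional is `BoseGas.fracPeriodicEnergy 2 v N L` by `rfl`, and
`BoseGas.fracPeriodicEnergy_two`. [cite: Fournais2020, (1.1)] -/
theorem fracEnergyAtTwo_proof :
    Summit.AtomisticToContinuum.BoseEinsteinCondensation.Theses.BECDispersionLadder.FracEnergyAtTwo := by
  unfold Theses.BECDispersionLadder.FracEnergyAtTwo
  intro v N L hL Ψ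
  exact BoseGas.fracPeriodicEnergy_two hL v Ψ

end Summit.AtomisticToContinuum.BoseEinsteinCondensation.Theorems
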